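import Literature.Geometry.Riemannian.LowEntropyHypersurfacesFourAssembly
import Literature.Geometry.Riemannian.HamiltonSurgeryProgramme
import Literature.Geometry.Riemannian.ShrinkingSphereMCF
import Literature.Topology.FourManifolds.NonseparatingNeckSurgery
import HarnessLib

/-!
# Low-entropy hypersurfaces of `ℝ⁵`, Cor. 1.5 (b) of Chodosh–Mantoulidis–Schulze 2025 for `n = 4`:
# the mean curvature flow with surgery ALONG NECKS, and the reduction of
# `ChodoshMantoulidisSchulze2025_cor15b_four` to it — without Cerf's `Γ₄ = 0`

Companion of `LowEntropyHypersurfacesFourAssembly.lean`, whose named fact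
`Literature.Geometry.Riemannian.ChodoshMantoulidisSchulze2025_cor15b_four` renders Cor. 1.5 (b)
(= Cor. 1.22 (b), unconditional for `n ≤ 5` by Remarks 1.16 and 1.17) of O. Chodosh,
C. Mantoulidis, F. Schulze, *Mean curvature flow with generic low-entropy initial data II*,
Duke Math. J. 174 (2025), arXiv:2309.03856, for `n = 4` and simply connected `M`: a simply
connected closed connected embedded hypersurface `ι : M⁴ ↪ ℝ⁵` with
`λ(ι(M)) ≤ λ(𝕊²(2) × ℝ²) = λ(𝕊²)` is diffeomorphic to the standard `𝕊⁴`; and an alternative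
to `LowEntropyHypersurfacesFourSurgery.lean`.

## The printed proof, and the two renderings of its flow with surgery

Proof of Cor. 1.22 (arXiv text, §1.6, p. 6): "either `M` is a round sphere (in which case we are
done), or we can find a small `C^∞` graph `M'` over `M` so that `λ(M') < Λ` and so that there is
`ℳ' ∈ 𝔉(M')` with `sing_non-gen ℳ' = ∅` [Thm. 1.13 / Cor. 1.19]. … In case (b), we additionally
use the surgery of [Daniels-Holgate]" — (Cor. 1.5 (b), p. 3) "the mean curvature flow with
surgery of [Daniels-Holgate] … provides a smooth isotopy from `M` to the boundary of a standard
handlebody". That flow with surgery (J. M. Daniels-Holgate, Adv. Math. 410 (2022), Thm. 1.3, in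
the formalism of Haslhofer–Kleiner recalled in §2.1 loc. cit.) consists of finitely many smooth
flows (Def. 2.20); at each stopping time "the final time slices of some collection of disjoint
strong `δ`-necks are replaced by pairs of standard caps" (Def. 2.20 (1), Def. 2.19), a standard
cap being "a smooth convex domain that coincides with a solid round half-cylinder of radius `1`
outside a ball of radius `10`" (Def. 2.18) and the post-surgery domain being "`δ`-close … to a
pair of disjoint standard caps" near the neck (Def. 2.19 (4)); then "some connected components
are discarded" (Def. 2.20 (2), Def. 2.26 (3)), and "all discarded components are diffeomorphic to
`D̄ⁿ⁺¹` or `D̄ⁿ × 𝕊¹`" (Thm. 2.29), i.e. their boundaries to `𝕊ⁿ` or `𝕊ⁿ⁻¹ × 𝕊¹`; the flow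
"vanishes in finite time" (Thm. 1.3). The topology is then read off backwards (Lemma 6.2 and the
proof of Thm. 6.4, pp. 20–21): the smooth flows are isotopies, a neck replacement "will either
disconnect … or break a handle", and "the reversing of the surgery is a connected sum".

`LowEntropyHypersurfacesFourSurgery.lean` rendered a surgery time in the *collared* reading of
Chen–Zhu's Ricci flow with surgery (`IsMCFSurgeryStep`: a kept compact domain identified with a
domain of an abstract post-surgery manifold, the complements described by collared pieces). That
reading forgets HOW the caps are attached to the kept part, and reversing a surgery then needs
Cerf's theorem `Γ₄ = 0` (`Literature.Topology.FourManifolds.cerf_pi0Diff_sphere_three`) to match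
the collar of a cap with the neck it replaced (`SurgicalRicciFlowBallAbsorption.lean`). But
Def. 2.18 / 2.19 say more: the cap continues the round cylinder of the neck, i.e. it is attached
along the neck's own product structure `𝕊³ × ℝ`. Topologically the post-surgery component is
therefore *the side of the neck with its end rounded off by a disc glued along the polar
identification of the half-neck* — exactly the tree's canonical capping
`Literature.Topology.FourManifolds.NeckCapData.Capped` (`NeckCapping.lean`; for a non-separating
neck the double cap `Literature.Topology.FourManifolds.DoubleCap.M`,
`NonseparatingNeckSurgery.lean`). Recording this, the present file renders the flow with surgery
as the inductive predicate `MCFNeckSurgeryResolvable` below, and the reversal of a surgery on a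
simply connected slice becomes LITERALLY the `surgery` constructor of
`Literature.Geometry.Riemannian.IsNeckSurgeryResolvable` (`HamiltonSurgeryProgramme.lean`), whose
consequences (`M ≅ 𝕊⁴`: separation of necks by Hirsch's Thm. 4.6, `P ≅ D₁.Capped # D₂.Capped`,
simple connectivity of the summands, Kervaire–Milnor's `𝕊⁴ # 𝕊⁴ ≅ 𝕊⁴`) are all proved in the
tree. **No input from Cerf's theorem remains.**

## Contents

* `IsMCFDiscardedComponent M` — `M ≅ 𝕊⁴` or `M` is `𝕊³ × 𝕊¹` (the mapping torus of `id_{𝕊³}`):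
  the boundaries of the discarded components of Thm. 2.29.
* `MCFNeckSurgeryResolvable M κ` — **the slice `κ : M → ℝ⁵` at a stopping time of a mean
  curvature flow with surgery is resolved by finitely many further operations**, generated by:
  `discard` (the component is a discarded one), `flow` (a classical mean curvature flow of
  embedded hypersurfaces, `IsClassicalMCF` of `MeanConvexLevelSetFlow.lean`, runs from the slice
  `F 0` for a time `T > 0` to the next stopping time, whose slice `F T` is resolved),
  `of_diffeomorph` (reparametrisation of the abstract manifold), `cut`
  (a separating neck `ψ : 𝕊³ × ℝ ↪ M` of the slice is replaced by two standard caps: the two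
  canonically capped sides, with new slices, are resolved) and `cutNonseparating` (the same for a
  non-separating neck, with the double cap). Several necks replaced at one stopping time are
  successive `cut`s (a neck disjoint from `ψ` is a neck of a capped side,
  `NeckCapData.isSmoothEmbedding_inl_comp`); nothing but the existence of the classical flows and
  the combinatorics of necks, caps and discarded components is recorded (metrics of necks, surgery
  parameters, and the position of the new slices relative to the old are forgotten, as in
  `IsNeckSurgeryResolvable`).
* `MCFNeckSurgeryFlowFrom M ι` — a classical mean curvature flow runs from `ι` for a positive
  time to a first stopping time whose slice is so resolved: "there is a smooth flow with surgery
  [from the hypersurface] that exists until the flow vanishes" (Thm. 1.3).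
* `MCFNeckSurgeryResolvable.isNeckSurgeryResolvable`, `.nonempty_diffeomorph_sphere`
  (**proved, no Cerf**): a simply connected slice so resolved is neck-surgery resolvable, hence
  diffeomorphic to `𝕊⁴` — Daniels-Holgate's backward induction (proof of Thm. 6.4): discarded
  components are model pieces; flows do not change the manifold; a cut along a separating neck is
  the `surgery` constructor (both capped sides being simply connected,
  `NeckCapData.isConnectedSum_capped` with `IsConnectedSum.simplyConnectedSpace_left/right`); a
  non-separating neck does not exist in a simply connected slice
  (`not_isPreconnected_compl_image_neck`, "no handles are broken").
* `ChodoshMantoulidisSchulze2025_cor15b_four_of_mcfNeckSurgeryFlowFrom` (**proved, no Cerf**; what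
  the topology consumes: round, or some map of `M` into `ℝ⁵` from which a flow with surgery runs)
  and `ChodoshMantoulidisSchulze2025_cor15b_four_of_neckSurgeryFlow` (**proved, no Cerf**): the named
  fact follows from the displayed ANALYTIC statement `hflow` — for every closed connected embedded
  `ι : M⁴ ↪ ℝ⁵` with `λ(ι(M)) ≤ λ(𝕊²(2) × ℝ²)`, either `ι(M)` is a round sphere, or for every
  `ε > 0` there is an embedding `ι₁` of `M`, `ε`-close to `ι` in `C⁰`, with
  `λ(ι₁(M)) < λ(𝕊²(2) × ℝ²)` and `MCFNeckSurgeryFlowFrom M ι₁` — which is what Thm. 1.13 /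
  Cor. 1.19 of the cited paper and Daniels-Holgate's Thm. 1.3 (with Def. 2.18–2.20, 2.26 and
  Thm. 2.29 of Haslhofer–Kleiner) deliver in the printed proof, for ALL closed connected `M`
  (simply connected or not: it carries the topological classification of Cor. 1.5 (b) for every
  such hypersurface, and is not derivable from the simply connected conclusion);
  `ChodoshMantoulidisSchulze2025_lowEntropy_sphere_four_of_flows`: the parent fact (both halves of
  Cor. 1.5 for `n = 4`) from the two flow statements (a) and (b), again without Cerf.
* Non-vacuity: the standard `𝕊⁴ ⊂ ℝ⁵` flows by homothetically shrinking spheres to a stopping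
  time at which it is discarded (`mcfNeckSurgeryFlowFrom_unitSphere`, Daniels-Holgate's
  Example 3.21).

No named fact is introduced (D-0026): the analytic statement is an explicit hypothesis. With this
file the trust base of `ChodoshMantoulidisSchulze2025_cor15b_four` is that single statement
(Chodosh–Mantoulidis–Schulze 2025, Thm. 1.13, and Daniels-Holgate 2022, Thm. 1.3 / Thm. 2.29, whose
proofs are the Brakke-flow analysis the tree lacks); Cerf 1968 is no longer part of it.

## References

* [ChodoshMantoulidisSchulze2025] O. Chodosh, C. Mantoulidis, F. Schulze, *Mean curvature flow
  with generic low-entropy initial data II*, Duke Math. J. 174 (2025), arXiv:2309.03856: Cor. 1.5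
  (p. 3), Rem. 1.9, Thm. 1.13, Rem. 1.16, Rem. 1.17, Cor. 1.19, Cor. 1.22 and its proof (§1.6, p. 6).
* [DanielsHolgate2022] J. M. Daniels-Holgate, *Approximation of mean curvature flow with generic
  singularities by smooth flows with surgery*, Adv. Math. 410 (2022) 108715, arXiv:2104.11647:
  Thm. 1.3 (p. 3), §2.1 (Def. 2.17–2.20, Def. 2.26, Thm. 2.27–2.29, pp. 6–8), §3 Example 3.21,
  §6 (Lemma 6.2, Thm. 6.4 and its proof, pp. 20–21).
* [HaslhoferKleiner2017] R. Haslhofer, B. Kleiner, *Mean curvature flow with surgery*, Duke Math.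
  J. 166 (2017) 1591–1626, arXiv:1404.2332 (the source recalled in DH's §2.1; numbering of the
  arXiv text): Def. 3 (`(α, δ)`-flow), Thm. 19 (canonical neighbourhoods), Cor. 22 (discarded
  components), Def. 27 (standard cap), Def. 29 (replacing a `δ`-neck by standard caps).
* [Hamilton1997] R. S. Hamilton, Comm. Anal. Geom. 5 (1997), §1.1 pp. 3–4 (the surgery programme).
-/

noncomputable section

open Set Function Metric TopologicalSpace Filter
open scoped Manifold ContDiff Topology

namespace Literature.Geometry.Riemannian

open Literature.Topology.FourManifolds Lorentzian

/-- Local notation: `𝔼 n` is the model Euclidean space `EuclideanSpace ℝ (Fin n)`. -/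
local notation "𝔼 " n:arg => EuclideanSpace ℝ (Fin n)

/-- Local notation: `𝕊 n` is the unit sphere in `EuclideanSpace ℝ (Fin (n + 1))`. -/
local notation "𝕊 " n:arg => (Metric.sphere (0 : EuclideanSpace ℝ (Fin (n + 1))) 1)

attribute [local instance] fact_finrank_euclideanSpace_succ

/-! ### The flow with surgery along necks -/

section Structure

/-- **A discarded component** of a mean curvature flow with surgery in `ℝ⁵`: a closed
4-manifold diffeomorphic to `𝕊⁴` or to `𝕊³ × 𝕊¹` (rendered, as in
`Literature.Geometry.Riemannian.IsHamiltonPICPiece`, as the mapping torus of the identity of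
`𝕊³`) — "all discarded components are diffeomorphic to `D̄ⁿ⁺¹` or `D̄ⁿ × 𝕊¹`"
([DanielsHolgate2022, Thm. 2.29], after Haslhofer–Kleiner), whose boundaries are `𝕊ⁿ` and
`𝕊ⁿ⁻¹ × 𝕊¹`, here `n = 4`. [cite: DanielsHolgate2022, Thm. 2.29] -/
def IsMCFDiscardedComponent (M : Type) [TopologicalSpace M] [ChartedSpace (𝔼 4) M] : Prop :=
  Nonempty (M ≃ₘ⟮𝓡 4, 𝓡 4⟯ 𝕊 4) ∨
    IsMappingTorusOf (I := 𝓡 3) (𝓡 4) M (Diffeomorph.refl (𝓡 3) (𝕊 3) ∞)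

/-- A discarded component is one of Hamilton's model pieces (`𝕊⁴`, `ℝℙ⁴`, `𝕊³ × 𝕊¹`,
`𝕊³ ×~ 𝕊¹`). [cite: DanielsHolgate2022, Thm. 2.29] -/
theorem IsMCFDiscardedComponent.isHamiltonPICPiece {M : Type} [TopologicalSpace M]
    [ChartedSpace (𝔼 4) M] (h : IsMCFDiscardedComponent M) : IsHamiltonPICPiece M := by
  rcases h with h | h
  · exact Or.inl h
  · exact Or.inr (Or.inr (Or.inl h))

/-- The standard `𝕊⁴` is a discarded component. [cite: DanielsHolgate2022, Thm. 2.29] -/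
theorem isMCFDiscardedComponent_sphere : IsMCFDiscardedComponent (𝕊 4) :=
  Or.inl ⟨Diffeomorph.refl (𝓡 4) (𝕊 4) ∞⟩

/-- A manifold diffeomorphic to `𝕊⁴` is a discarded component. [cite: DanielsHolgate2022, Thm. 2.29] -/
theorem IsMCFDiscardedComponent.of_nonempty_diffeomorph_sphere {M : Type} [TopologicalSpace M]
    [ChartedSpace (𝔼 4) M] (h : Nonempty (M ≃ₘ⟮𝓡 4, 𝓡 4⟯ 𝕊 4)) : IsMCFDiscardedComponent M :=
  Or.inl h

/-- **The slice `κ : M → ℝ⁵` at a stopping time of a mean curvature flow with surgery in `ℝ⁵`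
is resolved by finitely many further flows, neck replacements and discardings** — the structure
of the flow with surgery of [DanielsHolgate2022, Thm. 1.3] in Haslhofer–Kleiner's formalism
(loc. cit. §2.1: Def. 2.20, an `(α, δ)`-flow is "a collection of finitely many smooth flows" such
that at each stopping time "(1) the final time slices of some collection of disjoint strong
`δ`-necks are replaced by pairs of standard caps" and "(2) the initial time slice of the next flow
is obtained … by discarding some connected components"; Def. 2.18 / 2.19: a standard cap
"coincides with a solid round half-cylinder … outside a ball", so it is attached along the
product structure of the neck it closes; Thm. 2.29: the discarded components), as the smallest
predicate on pairs (closed 4-manifold `M`, slice `κ : M → ℝ⁵`) such that: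
* `discard`: every slice of a discarded component (`IsMCFDiscardedComponent M`: `M ≅ 𝕊⁴` or
  `𝕊³ × 𝕊¹`) is resolved;
* `flow`: if a classical mean curvature flow of embedded closed hypersurfaces `F` (`IsClassicalMCF`
  for the Euclidean metric of `ℝ⁵`, `MeanConvexLevelSetFlow.lean`) runs on `[0, T]`, `T > 0`, and
  its final slice `F T` is resolved, then its initial slice `F 0` is resolved ("finitely many
  smooth flows", each up to the next stopping time);
* `of_diffeomorph`: resolution is invariant under reparametrisation of the abstract manifold by a
  diffeomorphism `e : M ≅ M'` (the slices `κ` and `κ ∘ e⁻¹` are the same hypersurface of `ℝ⁵`;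
  Haslhofer–Kleiner's objects are subsets of `ℝ⁵`, the abstract parametrisation is bookkeeping,
  as in `IsNeckSurgeryResolvable.of_diffeomorph`);
* `cut`: if `ψ : 𝕊³ × ℝ ↪ M` is a neck of `M` whose middle sphere separates `M` into the sides
  `D₁`, `D₂` (`Literature.Topology.FourManifolds.NeckCapData`), and the two CANONICALLY CAPPED
  sides `D₁.Capped`, `D₂.Capped` (`NeckCapping.lean`: the side with its end rounded off by a disc
  glued along the polar identification of the half-neck — the topological type of "the side with
  the neck replaced by a standard cap", Def. 2.18 / 2.19) carry slices `κ₁`, `κ₂` that are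
  resolved, then `κ` is resolved;
* `cutNonseparating`: the same for a neck whose middle sphere does not separate, the post-surgery
  manifold being the double cap `Literature.Topology.FourManifolds.DoubleCap.M`
  (`NonseparatingNeckSurgery.lean`; "break a handle", [DanielsHolgate2022, Lemma 6.2 (ii)]).
Several necks replaced at the same stopping time are successive cuts (a neck disjoint from `ψ`
lies in one side and is a neck of its cap). As in `IsNeckSurgeryResolvable`, only what the
topological argument uses is recorded: the geometry of the necks, the surgery parameters and the
position of the new slices `κ₁`, `κ₂` (in Haslhofer–Kleiner: the post-surgery hypersurface)
relative to `κ` are forgotten; a slice that flows again is an embedding, being the initial slice of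
a classical flow. [cite: DanielsHolgate2022, Thm. 1.3, §2.1 Def. 2.18, Def. 2.19, Def. 2.20, Def. 2.26, Thm. 2.29]
[cite: HaslhoferKleiner2017, arXiv Def. 3, Def. 27, Def. 29, Cor. 22] -/
inductive MCFNeckSurgeryResolvable :
    ∀ (M : Type) [TopologicalSpace M] [ChartedSpace (𝔼 4) M], (M → 𝔼 5) → Prop
  /-- Discarding: a slice of a discarded component (`≅ 𝕊⁴` or `𝕊³ × 𝕊¹`) is resolved. -/
  | discard {M : Type} [TopologicalSpace M] [ChartedSpace (𝔼 4) M]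
      (hM : IsMCFDiscardedComponent M) (κ : M → 𝔼 5) : MCFNeckSurgeryResolvable M κ
  /-- Flowing: a classical mean curvature flow of embedded hypersurfaces runs from the slice
  `F 0` on `[0, T]`, `T > 0`, and its final slice `F T` is resolved. -/
  | flow {M : Type} [TopologicalSpace M] [T2Space M] [ChartedSpace (𝔼 4) M]
      [IsManifold (𝓡 4) ∞ M] {F : ℝ → M → 𝔼 5}
      {ν : (t : ℝ) → Lorentzian.NormalField (𝓡 5) (F t)} {T : ℝ} (hT : 0 < T)
      (hF : IsClassicalMCF (euclideanMetric (𝔼 5)) F ν 0 T)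
      (h : MCFNeckSurgeryResolvable M (F T)) : MCFNeckSurgeryResolvable M (F 0)
  /-- Reparametrisation: a slice is resolved with any reparametrisation `κ ∘ e⁻¹` of it by a
  diffeomorphism `e : M ≅ M'` of the abstract manifold (the same hypersurface of `ℝ⁵`). -/
  | of_diffeomorph {M M' : Type} [TopologicalSpace M] [ChartedSpace (𝔼 4) M]
      [TopologicalSpace M'] [ChartedSpace (𝔼 4) M'] [IsManifold (𝓡 4) ∞ M'] {κ : M → 𝔼 5}
      (h : MCFNeckSurgeryResolvable M κ) (e : M ≃ₘ⟮𝓡 4, 𝓡 4⟯ M') :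
      MCFNeckSurgeryResolvable M' (κ ∘ e.symm)
  /-- Surgery on a separating neck: the neck `ψ` is cut at its middle sphere and its two sides
  are capped canonically; both capped sides, with their new slices, are resolved. -/
  | cut {M : Type} [TopologicalSpace M] [T2Space M] [ChartedSpace (𝔼 4) M]
      [IsManifold (𝓡 4) ∞ M] (κ : M → 𝔼 5) {ψ : (𝕊 3) × ℝ → M} (D₁ : NeckCapData 3 ψ)
      (D₂ : NeckCapData 3 (fun q : (𝕊 3) × ℝ => ψ (q.1, -q.2)))
      (hdisj : Disjoint (D₁.side : Set M) D₂.side)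
      (hcover : ∀ p : M, p ∉ D₁.side → p ∉ D₂.side → ∃ θ : 𝕊 3, ψ (θ, 0) = p)
      (κ₁ : D₁.Capped → 𝔼 5) (κ₂ : D₂.Capped → 𝔼 5)
      (h₁ : MCFNeckSurgeryResolvable D₁.Capped κ₁) (h₂ : MCFNeckSurgeryResolvable D₂.Capped κ₂) :
      MCFNeckSurgeryResolvable M κ
  /-- Surgery on a non-separating neck: the neck `ψ` is cut at its middle sphere and both ends
  are capped canonically (the double cap); the capped manifold, with its new slice, is
  resolved. -/
  | cutNonseparating {M : Type} [TopologicalSpace M] [T2Space M] [ChartedSpace (𝔼 4) M]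
      [IsManifold (𝓡 4) ∞ M] (κ : M → 𝔼 5) {ψ : (𝕊 3) × ℝ → M}
      (hψ : Manifold.IsSmoothEmbedding ((𝓡 3).prod 𝓘(ℝ, ℝ)) (𝓡 4) ∞ ψ) (hψo : IsOpen (range ψ))
      (hns : IsPreconnected (ψ '' (univ ×ˢ ({0} : Set ℝ)))ᶜ)
      (κ' : DoubleCap.M hψ hψo → 𝔼 5) (h : MCFNeckSurgeryResolvable (DoubleCap.M hψ hψo) κ') :
      MCFNeckSurgeryResolvable M κ

/-- **A mean curvature flow with surgery runs from the closed embedded hypersurface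
`ι : M ↪ ℝ⁵` and vanishes in finite time** ([DanielsHolgate2022, Thm. 1.3]: "there is a smooth
flow with surgery that exists until the flow vanishes"): a classical mean curvature flow of
embedded hypersurfaces runs from `ι` on `[0, T]`, `T > 0` (up to the first stopping time), and
its final slice is resolved by finitely many further flows, neck replacements and discardings
(`MCFNeckSurgeryResolvable`). [cite: DanielsHolgate2022, Thm. 1.3, §2.1 Def. 2.20, Def. 2.26] -/
def MCFNeckSurgeryFlowFrom (M : Type) [TopologicalSpace M] [T2Space M] [ChartedSpace (𝔼 4) M]
    [IsManifold (𝓡 4) ∞ M] (ι : M → 𝔼 5) : Prop :=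
  ∃ (F : ℝ → M → 𝔼 5) (ν : (t : ℝ) → Lorentzian.NormalField (𝓡 5) (F t)) (T : ℝ),
    0 < T ∧ IsClassicalMCF (euclideanMetric (𝔼 5)) F ν 0 T ∧ F 0 = ι ∧
    MCFNeckSurgeryResolvable M (F T)

variable {M : Type} [TopologicalSpace M] [T2Space M] [ChartedSpace (𝔼 4) M] [IsManifold (𝓡 4) ∞ M]

/-- The `flow` constructor with the initial slice named: if a classical flow runs from `ι` on
`[0, T]`, `T > 0`, to a resolved slice, then `ι` is resolved. [cite: DanielsHolgate2022, §2.1 Def. 2.20] -/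
theorem MCFNeckSurgeryResolvable.flow_of_eq {F : ℝ → M → 𝔼 5}
    {ν : (t : ℝ) → Lorentzian.NormalField (𝓡 5) (F t)} {T : ℝ} {ι : M → 𝔼 5} (hT : 0 < T)
    (hF : IsClassicalMCF (euclideanMetric (𝔼 5)) F ν 0 T) (h0 : F 0 = ι)
    (h : MCFNeckSurgeryResolvable M (F T)) : MCFNeckSurgeryResolvable M ι :=
  h0 ▸ MCFNeckSurgeryResolvable.flow hT hF h

/-- A hypersurface from which a flow with surgery runs is, in particular, a resolved slice.
[cite: DanielsHolgate2022, Thm. 1.3] -/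
theorem MCFNeckSurgeryFlowFrom.mcfNeckSurgeryResolvable {ι : M → 𝔼 5}
    (h : MCFNeckSurgeryFlowFrom M ι) : MCFNeckSurgeryResolvable M ι := by
  obtain ⟨F, ν, T, hT, hF, h0, hres⟩ := h
  exact MCFNeckSurgeryResolvable.flow_of_eq hT hF h0 hres

/-- The initial hypersurface of a flow with surgery is embedded (injective): it is the time-`0`
slice of a classical flow of embedded hypersurfaces. [folklore] -/
theorem MCFNeckSurgeryFlowFrom.injective {ι : M → 𝔼 5} (h : MCFNeckSurgeryFlowFrom M ι) :
    Injective ι := by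
  obtain ⟨F, ν, T, hT, hF, h0, -⟩ := h
  rw [← h0]
  exact hF.injective 0 ⟨le_rfl, hT.le⟩

end Structure

/-! ### Non-vacuity: the round sphere flows to a stopping time and is discarded -/

section Round

/-- **A flow with surgery runs from the standard `𝕊⁴ ⊂ ℝ⁵`**: the homothetically shrinking
spheres `y ↦ √(1 - 8t) · y` (`ShrinkingSphereMCF.lean`, a classical flow on `[0, 1/16]`) run to
the stopping time `1/16`, at which the slice, a sphere, is discarded — "the shrinking sphere that
vanishes once the mean curvature reaches `H_th`" of [DanielsHolgate2022, Example 3.21].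
[cite: DanielsHolgate2022, §3, Example 3.21] -/
theorem mcfNeckSurgeryFlowFrom_unitSphere :
    MCFNeckSurgeryFlowFrom (Metric.sphere (0 : 𝔼 5) 1)
      (Subtype.val : Metric.sphere (0 : 𝔼 5) 1 → 𝔼 5) := by
  refine ⟨shrinkingSphereFlowAt 4 0 (1 / 8), shrinkingSphereNormalAt 4 0 (1 / 8), 1 / 16,
    by norm_num, isClassicalMCF_shrinkingSphereAt (by norm_num) 0 _ (by norm_num), ?_,
    MCFNeckSurgeryResolvable.discard isMCFDiscardedComponent_sphere _⟩
  funext y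
  simp only [shrinkingSphereFlowAt, shrinkingSphereRadius, zero_add, sub_zero]
  norm_num

/-- The inclusion of the standard `𝕊⁴` is a resolved slice. [cite: DanielsHolgate2022, §3, Example 3.21] -/
theorem mcfNeckSurgeryResolvable_unitSphere :
    MCFNeckSurgeryResolvable (Metric.sphere (0 : 𝔼 5) 1)
      (Subtype.val : Metric.sphere (0 : 𝔼 5) 1 → 𝔼 5) :=
  mcfNeckSurgeryFlowFrom_unitSphere.mcfNeckSurgeryResolvable

end Round

/-! ### The topology of the flow with surgery (no input from Cerf's theorem) -/

section Topology

/-- **A simply connected slice resolved by a mean curvature flow with surgery along necks is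
neck-surgery resolvable** — Daniels-Holgate's backward induction ([DanielsHolgate2022, proof of
Thm. 6.4, pp. 20–21]: "all dropped components are … spheres and no handles are broken … the
reversing of the surgery is a connected sum of spheres") over the structure, the flows being
forgotten: a discarded component is a model piece (`IsNeckSurgeryResolvable.piece`); a classical
flow does not change the manifold, a reparametrisation replaces it by a diffeomorphic one
(`IsNeckSurgeryResolvable.of_diffeomorph`); a cut along a separating neck is the `surgery` constructor of
`IsNeckSurgeryResolvable`, both canonically capped sides being simply connected with `M`
(`NeckCapData.isConnectedSum_capped`: `M ≅ D₁.Capped # D₂.Capped`, and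
`IsConnectedSum.simplyConnectedSpace_left/right`, Kosinski VI Prop. 2.1); and a simply connected
slice has no non-separating neck (`not_isPreconnected_compl_image_neck`, Hirsch's Thm. 4.6: "no
handles are broken"). No appeal to Cerf's `Γ₄ = 0` is made: the caps are attached along the
necks' own product structure. [cite: DanielsHolgate2022, Lemma 6.2 and proof of Thm. 6.4 (pp. 20–21)]
[cite: Hamilton1997, §1.1 pp. 3–4] -/
theorem MCFNeckSurgeryResolvable.isNeckSurgeryResolvable {M : Type} [TopologicalSpace M]
    [ChartedSpace (𝔼 4) M] {κ : M → 𝔼 5} (h : MCFNeckSurgeryResolvable M κ)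
    (hsc : SimplyConnectedSpace M) : IsNeckSurgeryResolvable M := by
  induction h with
  | discard hM κ => exact .piece hM.isHamiltonPICPiece
  | flow hT hF h ih => exact ih hsc
  | of_diffeomorph h e ih =>
    exact (ih ((e.toHomeomorph.toHomotopyEquiv.simplyConnectedSpace_iff).2 hsc)).of_diffeomorph e
  | cut κ D₁ D₂ hdisj hcover κ₁ κ₂ h₁ h₂ ih₁ ih₂ =>
    haveI := hsc
    have hcs := D₁.isConnectedSum_capped D₂ (fun _ _ => rfl) hdisj hcover
    have h2 : 1 < Module.finrank ℝ (𝔼 4) := by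
      rw [finrank_euclideanSpace_fin]
      norm_num
    exact .surgery D₁ D₂ hdisj hcover (ih₁ (hcs.simplyConnectedSpace_left h2))
      (ih₂ (hcs.simplyConnectedSpace_right h2))
  | cutNonseparating κ hψ hψo hns κ' h ih =>
    rename_i M _ _ _ _ ψ
    haveI := hsc
    haveI : LocallyPathConnectedSpace M := ChartedSpace.locallyPathConnectedSpace (𝔼 4) M
    haveI : Nonempty (𝕊 3) := ⟨unitSpherePoint 3⟩
    exact absurd hns (not_isPreconnected_compl_image_neck ⟨hψ.isEmbedding, hψo⟩)

/-- **A simply connected closed 4-manifold, a slice of which is resolved by a mean curvature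
flow with surgery along necks, is diffeomorphic to `𝕊⁴`** (no input from Cerf's theorem): it is
neck-surgery resolvable, hence a connected sum of copies of `𝕊⁴`
(`IsNeckSurgeryResolvable.nonempty_diffeomorph_sphere`, with Kervaire–Milnor's `𝕊⁴ # 𝕊⁴ ≅ 𝕊⁴`).
[cite: DanielsHolgate2022, proof of Thm. 6.4 (pp. 20–21)] [cite: ChodoshMantoulidisSchulze2025, Cor. 1.5 (b)] -/
theorem MCFNeckSurgeryResolvable.nonempty_diffeomorph_sphere {M : Type} [TopologicalSpace M]
    [ChartedSpace (𝔼 4) M] [IsManifold (𝓡 4) ∞ M] {κ : M → 𝔼 5}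
    (h : MCFNeckSurgeryResolvable M κ) (hsc : SimplyConnectedSpace M) :
    Nonempty (M ≃ₘ⟮𝓡 4, 𝓡 4⟯ 𝕊 4) :=
  (h.isNeckSurgeryResolvable hsc).nonempty_diffeomorph_sphere hsc

/-- **A simply connected closed 4-manifold from an embedding of which into `ℝ⁵` a mean
curvature flow with surgery runs is diffeomorphic to `𝕊⁴`** (no input from Cerf's theorem).
[cite: DanielsHolgate2022, Thm. 1.3 and proof of Thm. 6.4 (pp. 20–21)] -/
theorem MCFNeckSurgeryFlowFrom.nonempty_diffeomorph_sphere {M : Type} [TopologicalSpace M]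
    [T2Space M] [ChartedSpace (𝔼 4) M] [IsManifold (𝓡 4) ∞ M] {ι : M → 𝔼 5}
    (h : MCFNeckSurgeryFlowFrom M ι) (hsc : SimplyConnectedSpace M) :
    Nonempty (M ≃ₘ⟮𝓡 4, 𝓡 4⟯ 𝕊 4) :=
  h.mcfNeckSurgeryResolvable.nonempty_diffeomorph_sphere hsc

end Topology

/-! ### The reduction of Cor. 1.5 (b), `n = 4`, to the flow with surgery — without Cerf -/

section Reduction

/-- **What the reduction consumes** (minimal form): `ChodoshMantoulidisSchulze2025_cor15b_four`
follows as soon as every closed connected embedded `ι : M⁴ ↪ ℝ⁵` with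
`λ(ι(M)) ≤ λ(𝕊²(2) × ℝ²)` either has image a round sphere or admits SOME map `ι₁ : M → ℝ⁵` from
which a mean curvature flow with surgery along necks runs (`MCFNeckSurgeryFlowFrom M ι₁`): in the
round case by `nonempty_diffeomorph_sphere_four_of_range_eq_sphere` ("either `M` is a round
sphere, in which case we are done", proof of Cor. 1.22, p. 6), otherwise by
`MCFNeckSurgeryFlowFrom.nonempty_diffeomorph_sphere`. The `C⁰`-closeness of `ι₁` to `ι` and the
entropy drop `λ(ι₁(M)) < Λ` of the printed statement (the hypothesis of
`ChodoshMantoulidisSchulze2025_cor15b_four_of_neckSurgeryFlow` below, which is the form to cite)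
are not used by the topological argument; this form only records that. No input from Cerf's
theorem. [cite: ChodoshMantoulidisSchulze2025, Cor. 1.5 (b), Cor. 1.22 (b) and proof (§1.6, p. 6)]
[cite: DanielsHolgate2022, Thm. 1.3, Lemma 6.2, proof of Thm. 6.4] -/
theorem ChodoshMantoulidisSchulze2025_cor15b_four_of_mcfNeckSurgeryFlowFrom
    (hflow : ∀ (M : Type) [TopologicalSpace M] [T2Space M] [SecondCountableTopology M]
      [CompactSpace M] [ConnectedSpace M] [ChartedSpace (𝔼 4) M] [IsManifold (𝓡 4) ∞ M]
      (ι : M → 𝔼 5), Manifold.IsSmoothEmbedding (𝓡 4) (𝓡 5) ∞ ι →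
      gaussianEntropy 4 (range ι) ≤ gaussianEntropy 4 (shrinkingCylinder 4 2) →
      (∃ (c : 𝔼 5) (r : ℝ), 0 < r ∧ range ι = Metric.sphere c r) ∨
      ∃ ι₁ : M → 𝔼 5, MCFNeckSurgeryFlowFrom M ι₁) :
    ChodoshMantoulidisSchulze2025_cor15b_four := by
  intro M _ _ _ _ _ _ _ hsc ι hι hent
  rcases hflow M ι hι hent with ⟨c, r, hr, hrange⟩ | ⟨ι₁, hres⟩
  · exact nonempty_diffeomorph_sphere_four_of_range_eq_sphere M hι hr hrange
  · exact hres.nonempty_diffeomorph_sphere hsc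

/-- **Cor. 1.5 (b) / Cor. 1.22 (b) for `n = 4` (simply connected case) from the printed analytic
input alone.** The hypothesis `hflow` displays, in the tree's vocabulary, what the printed proof
(p. 6) obtains before any topology: for a closed connected embedded `ι : M⁴ ↪ ℝ⁵` with
`λ(ι(M)) ≤ λ(𝕊²(2) × ℝ²)` (`= λ(𝕊²)`), "either `M` is a round sphere (in which case we are
done), or we can find a small `C^∞` graph `M'` over `M` so that `λ(M') < Λ`" whose flow has
`sing_non-gen = ∅` [Thm. 1.13 / Cor. 1.19, unconditional for `n = 4` by Rem. 1.16, 1.17 (a)],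
hence — `λ < λ(𝕊²)` leaving only multiplicity-one `𝕊⁴`- and `𝕊³ × ℝ`-type singularities
(Rem. 1.9) — admits "the mean curvature flow with surgery of [Daniels-Holgate]"
([DanielsHolgate2022, Thm. 1.3]: smooth flows between finitely many stopping times, necks replaced
by standard caps attached along the necks, Def. 2.18–2.20, discarded components `𝕊⁴` or
`𝕊³ × 𝕊¹`, Thm. 2.29, vanishing in finite time): rendered as — either `range ι` is a round
sphere, or for every `ε > 0` there is a `C^∞` embedding `ι₁ : M → ℝ⁵` (the graph `M'`, an
embedded copy of `M`) with `‖ι₁ x - ι x‖ ≤ ε` for all `x`, `λ(ι₁(M)) < λ(𝕊²(2) × ℝ²)`, and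
`MCFNeckSurgeryFlowFrom M ι₁`. Conclusion: the named fact
`ChodoshMantoulidisSchulze2025_cor15b_four` — in the round case by
`nonempty_diffeomorph_sphere_four_of_range_eq_sphere`, otherwise by
`MCFNeckSurgeryFlowFrom.nonempty_diffeomorph_sphere` (Daniels-Holgate's backward induction). The
hypothesis is not a named fact of the tree (D-0026); it speaks of every closed connected `M` and
its proof is the Brakke-flow analysis of the two cited papers, absent from Mathlib and the tree.
Unlike `ChodoshMantoulidisSchulze2025_cor15b_four_of_perturbedSurgeryFlow_of_cerf`
(`LowEntropyHypersurfacesFourSurgery.lean`), no input from Cerf's `Γ₄ = 0` is needed.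
[cite: ChodoshMantoulidisSchulze2025, Cor. 1.5 (b) (p. 3), Cor. 1.22 (b) and proof (§1.6, p. 6), Thm. 1.13, Cor. 1.19, Rem. 1.9]
[cite: DanielsHolgate2022, Thm. 1.3, §2.1 Def. 2.18–2.20, Def. 2.26, Thm. 2.29, Lemma 6.2, proof of Thm. 6.4] -/
theorem ChodoshMantoulidisSchulze2025_cor15b_four_of_neckSurgeryFlow
    (hflow : ∀ (M : Type) [TopologicalSpace M] [T2Space M] [SecondCountableTopology M]
      [CompactSpace M] [ConnectedSpace M] [ChartedSpace (𝔼 4) M] [IsManifold (𝓡 4) ∞ M]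
      (ι : M → 𝔼 5), Manifold.IsSmoothEmbedding (𝓡 4) (𝓡 5) ∞ ι →
      gaussianEntropy 4 (range ι) ≤ gaussianEntropy 4 (shrinkingCylinder 4 2) →
      (∃ (c : 𝔼 5) (r : ℝ), 0 < r ∧ range ι = Metric.sphere c r) ∨
      ∀ ε : ℝ, 0 < ε → ∃ ι₁ : M → 𝔼 5, Manifold.IsSmoothEmbedding (𝓡 4) (𝓡 5) ∞ ι₁ ∧
        (∀ x, ‖ι₁ x - ι x‖ ≤ ε) ∧
        gaussianEntropy 4 (range ι₁) < gaussianEntropy 4 (shrinkingCylinder 4 2) ∧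
        MCFNeckSurgeryFlowFrom M ι₁) :
    ChodoshMantoulidisSchulze2025_cor15b_four := by
  refine ChodoshMantoulidisSchulze2025_cor15b_four_of_mcfNeckSurgeryFlowFrom
    fun M _ _ _ _ _ _ _ ι hι hent => ?_
  rcases hflow M ι hι hent with hround | hpert
  · exact Or.inl hround
  · obtain ⟨ι₁, -, -, -, hres⟩ := hpert 1 one_pos
    exact Or.inr ⟨ι₁, hres⟩

/-- **Cor. 1.5 for `n = 4` (both halves, the parent fact
`ChodoshMantoulidisSchulze2025_lowEntropy_sphere_four`) from the two flow statements, without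
Cerf**: half (a) from the smooth flow to a round point
(`ChodoshMantoulidisSchulze2025_smoothFlow_roundPoint_four`, a named fact of the assembly file),
half (b) from the flow with surgery along necks (the displayed hypothesis `hb`, as in
`ChodoshMantoulidisSchulze2025_cor15b_four_of_neckSurgeryFlow`), assembled by
`ChodoshMantoulidisSchulze2025_lowEntropy_sphere_four_holds_of`.
[cite: ChodoshMantoulidisSchulze2025, Cor. 1.5 (a), (b) and Cor. 1.22, proof p. 6]
[cite: DanielsHolgate2022, Thm. 1.3, Thm. 2.29, proof of Thm. 6.4] -/
theorem ChodoshMantoulidisSchulze2025_lowEntropy_sphere_four_of_flows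
    (ha : ChodoshMantoulidisSchulze2025_smoothFlow_roundPoint_four)
    (hb : ∀ (M : Type) [TopologicalSpace M] [T2Space M] [SecondCountableTopology M]
      [CompactSpace M] [ConnectedSpace M] [ChartedSpace (𝔼 4) M] [IsManifold (𝓡 4) ∞ M]
      (ι : M → 𝔼 5), Manifold.IsSmoothEmbedding (𝓡 4) (𝓡 5) ∞ ι →
      gaussianEntropy 4 (range ι) ≤ gaussianEntropy 4 (shrinkingCylinder 4 2) →
      (∃ (c : 𝔼 5) (r : ℝ), 0 < r ∧ range ι = Metric.sphere c r) ∨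
      ∀ ε : ℝ, 0 < ε → ∃ ι₁ : M → 𝔼 5, Manifold.IsSmoothEmbedding (𝓡 4) (𝓡 5) ∞ ι₁ ∧
        (∀ x, ‖ι₁ x - ι x‖ ≤ ε) ∧
        gaussianEntropy 4 (range ι₁) < gaussianEntropy 4 (shrinkingCylinder 4 2) ∧
        MCFNeckSurgeryFlowFrom M ι₁) :
    ChodoshMantoulidisSchulze2025_lowEntropy_sphere_four :=
  ChodoshMantoulidisSchulze2025_lowEntropy_sphere_four_holds_of ha
    (ChodoshMantoulidisSchulze2025_cor15b_four_of_neckSurgeryFlow hb)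

end Reduction

end Literature.Geometry.Riemannian

end
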